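import Literature.AlgebraicGeometry.Frobenioids.PadicKummerThm24iFrobenioidRelBaseEquivalence
import Literature.AlgebraicGeometry.Frobenioids.EquivalencePreStepsFSMFF2008Assembly
import Literature.AlgebraicGeometry.Frobenioids.PadicFrobenioidRelCosetBase
import Literature.AlgebraicGeometry.Frobenioids.ModelFrobenioidEndMonoid
import Literature.AnabelianGeometry.SemiGraphs.CosetCategoriesSlimTempered
import HarnessLib

/-!
# Frobenioids II, Theorem 2.4 (i) over GENERAL bases from an equivalence `Ψ : C₁ ⥲ C₂` ALONE:
# `Ψ_Base`, `η` ([FrdI] Thm. 3.4 (v)) and "`Ψ` preserves `O^⊳`" ([FrdI] Thm. 3.4 (iv)) DISCHARGED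

Mochizuki, *The geometry of Frobenioids II*, Kyushu J. Math. **62** (2008) 401–460, §2, Theorem 2.4 p. 19
[cite: MochizukiFrdII2008, Thm 2.4 (i) p.19]: "`Πi → Qi = G_{ℚ_{pᵢ}}` is an open homomorphism of temp-slim tempered topological
groups … an equivalence of categories `Ψ : C₁ ⥲ C₂` — which [cf. Theorem 1.2, (i); Example 1.3, (i); [Mzk5], Theorem 3.4, (v)]
necessarily induces a 1-compatible equivalence of categories `Ψ_Base : D₁ ⥲ D₂`, hence an outer isomorphism of topological
groups `Π₁ ⥲ Π₂` [cf. [Mzk2], Proposition 3.2; [Mzk2], Theorem A.4] that lies over an outer isomorphism of topological groups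
`G₁ ⥲ G₂` [cf. Theorem 1.2, (ii)]. Assume that this isomorphism `G₁ ⥲ G₂` maps `H₁` onto `H₂`. Then … (i) …".

Final assembly (seat abc-iut-L1-t7, gen 6) over the capstone `PadicKummerThm24iFrobenioidRelBaseEquivalence.lean` (Theorem 2.4
(i) over general bases modulo {hO, `Ψ_Base` + `η`, map_H, hfs}).  Here the two [FrdI] inputs are DISCHARGED from the tree's
PROVED [FrdI] Theorem 3.4 (abc-iut-L1-t13/L1-t11 lineages, `FrdI.Thm34iv_holds` / `FrdI.Thm34v_holds`) at the `p`-adic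
Frobenioids over `Dᵢ = B^temp(Πᵢ, Πᵢ°)⁰` (small model `RelCosetCat Πᵢ°`), whose hypotheses hold by [FrdII] Thm. 1.2 (i)
(abc-iut-L1-t4/L1-d8/L1-d10: `Datum.rel_isFrobenioid`, `rel_isOfStandardType`, `thm12_not_isGroupLike`) and by print's standing
hypothesis "temp-slim tempered" (`IsSlimGroup`, `IsTempered` ⇒ `Dᵢ` slim: abc-iut-L5-t2 lineage's
`CosetCat.isSlim_of_isSlimGroup_of_isTempered` + `RelCosetCat.isSlim_of_isSlim`):

* §1 `Datum.rel_not_isOfGroupLikeType`, `Datum.rel_isSlim_base`, `hypB_rel` (hypothesis (b) of Thm. 3.4 is vacuous: `C` is not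
  of group-like type);
* §2 `exists_baseEquivalence` — **`Ψ_Base : D₁ ⥲ D₂` an EQUIVALENCE with `η : Ψ ⋙ Base₂ ≅ Base₁ ⋙ Ψ_Base`** (Thm. 3.4 (v));
  `map_mem_endSubmonoid_iff` — **`f ∈ O^⊳(A) ↔ Ψ f ∈ O^⊳(Ψ A)`** (Thm. 3.4 (iv) for `Ψ` and `Ψ⁻¹`, conjugation-invariance of
  `O^⊳`);
* §3 chosen `baseEquivalenceOf`/`baseEquivalenceIso` and **`thm24i_ofEquivalenceRel`: Theorem 2.4 (i) for the `p`-adic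
  Frobenioids over GENERAL bases `B^temp(Πᵢ, Πᵢ°)⁰` (`Πᵢ` temp-slim tempered, `Π₁` Galois-countable) from an equivalence
  `Ψ : C₁ ⥲ C₂` modulo EXACTLY {map_H (the printed ASSUMPTION "this isomorphism `G₁ ⥲ G₂` maps `H₁` onto `H₂`", for the chosen
  representative), hfs (row L03: "`Φ₁` fieldwise saturated iff `Φ₂`", the clause (i) itself states first)}** — every other
  input of abc-iut-L1-t7's chain (`Ψ_Base`, `η`, hO, `θ`, `e`, `compat`, `hkerθ`, `isoG`, `houter`, `hbase`) is now a THEOREM.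

Bookkeeping over landed files; nothing here concerns [IUTchIII]; no statement of the paper is strengthened.
-/

noncomputable section

namespace Literature.AlgebraicGeometry.Frobenioids

namespace PadicFrd

open CategoryTheory Function Literature.AnabelianGeometry.SemiGraphs QuasiTemperoid

/-! ### §1 The hypotheses of [FrdI] Thm. 3.4 at the `p`-adic Frobenioids over `RelCosetCat Π°` -/

section OneDatum

variable {p : ℕ} [Fact p.Prime] {P : Type} [Group P] [TopologicalSpace P] {P₀ : OpenSubgroup P}
  (d : Datum (RelCosetCat P₀) p)

/-- **Thm. 1.2 (i): `C` is not of group-like type** (in the `PreFrobenioidData` vocabulary of [FrdI] Thm. 3.4).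
[cite: MochizukiFrdII2008, Thm 1.2 (i) p.9] -/
theorem Datum.rel_not_isOfGroupLikeType : ¬ (PreFrobenioidData.ofFunctor d.Φ d.structureFunctor).IsOfGroupLikeType :=
  fun h => d.thm12_not_isGroupLike fun A => h.obj A

/-- **The base `D = B^temp(Π, Π°)⁰` is slim for `Π` temp-slim tempered** ([SemiAnbd] Rmk. 3.4.1; the tree's
`CosetCat.isSlim_of_isSlimGroup_of_isTempered`, inherited by the relative base). [cite: MochizukiFrdII2008, Ex 1.3 (i) p.11] -/
theorem Datum.rel_isSlim_base [IsTopologicalGroup P] (hP : IsTempered P) (hZ : IsSlimGroup P) : IsSlim (RelCosetCat P₀) :=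
  RelCosetCat.isSlim_of_isSlim P₀ (CosetCat.isSlim_of_isSlimGroup_of_isTempered hP hZ)

/-- `O^⊳` is stable under conjugation by isomorphisms (model Frobenioid: `Base = id`, `deg_Fr = 1` are).
[cite: MochizukiFrdI2008, Def. 1.2(ii) p.22] -/
theorem Datum.conj_mem_endSubmonoid {X Y : d.frobenioid} (e : X ≅ Y) {g : Y ⟶ Y}
    (hg : g ∈ PreFrobenioid.endSubmonoid d.structureFunctor Y) :
    e.hom ≫ g ≫ e.inv ∈ PreFrobenioid.endSubmonoid d.structureFunctor X := by
  rw [ModelFrobenioid.mem_endSubmonoid_iff] at hg ⊢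
  haveI : IsIso e.hom := e.isIso_hom
  haveI : IsIso e.inv := e.isIso_inv
  refine ⟨?_, ?_⟩
  · rw [ModelFrobenioid.baseMap_comp, ModelFrobenioid.baseMap_comp, hg.1, Category.id_comp, ← ModelFrobenioid.baseMap_comp,
      Iso.hom_inv_id, ModelFrobenioid.baseMap_id]
  · rw [ModelFrobenioid.degFr_comp, ModelFrobenioid.degFr_comp, hg.2, ModelFrobenioid.degFr_eq_one_of_isIso e.hom,
      ModelFrobenioid.degFr_eq_one_of_isIso e.inv, mul_one, mul_one]

/-- … hence `f ∈ O^⊳(X)` as soon as its conjugate `e⁻¹ f e ∈ O^⊳(Y)`. [cite: MochizukiFrdI2008, Def. 1.2(ii) p.22] -/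
theorem Datum.mem_endSubmonoid_of_conj_mem {X Y : d.frobenioid} (e : X ≅ Y) {f : X ⟶ X}
    (h : e.inv ≫ f ≫ e.hom ∈ PreFrobenioid.endSubmonoid d.structureFunctor Y) :
    f ∈ PreFrobenioid.endSubmonoid d.structureFunctor X := by
  have h' := d.conj_mem_endSubmonoid e h
  have hf : e.hom ≫ (e.inv ≫ f ≫ e.hom) ≫ e.inv = f := by simp
  rwa [hf] at h'

end OneDatum

/-! ### §2 `Ψ_Base`, `η` and "`Ψ` preserves `O^⊳`" from [FrdI] Theorem 3.4 (iv), (v) -/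

section TwoData

variable {p₁ p₂ : ℕ} [Fact p₁.Prime] [Fact p₂.Prime]
  {P₁ : Type} [Group P₁] [TopologicalSpace P₁] [IsTopologicalGroup P₁] (hP₁ : IsTempered P₁) (hZ₁ : IsSlimGroup P₁)
  {P₁₀ : OpenSubgroup P₁} {d₁ : Datum (RelCosetCat P₁₀) p₁}
  {P₂ : Type} [Group P₂] [TopologicalSpace P₂] [IsTopologicalGroup P₂] (hP₂ : IsTempered P₂) (hZ₂ : IsSlimGroup P₂)
  {P₂₀ : OpenSubgroup P₂} {d₂ : Datum (RelCosetCat P₂₀) p₂}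
  (Ψ : d₁.frobenioid ≌ d₂.frobenioid)

omit [IsTopologicalGroup P₁] [IsTopologicalGroup P₂] in
/-- Hypothesis (b) of [FrdI] Thm. 3.4 ("if `C₁, C₂` are of group-like type, then …") is VACUOUS for `p`-adic Frobenioids.
[cite: MochizukiFrdII2008, Thm 1.2 (i) p.9] -/
theorem hypB_rel : PreFrobenioidData.HypB (PreFrobenioidData.ofFunctor d₁.Φ d₁.structureFunctor)
    (PreFrobenioidData.ofFunctor d₂.Φ d₂.structureFunctor) Ψ :=
  fun h₁ _ => absurd h₁ d₁.rel_not_isOfGroupLikeType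

include hP₁ hZ₁ hP₂ hZ₂ in
/-- **"`Ψ` necessarily induces a 1-compatible equivalence of categories `Ψ_Base : D₁ ⥲ D₂`" — from [FrdI] Thm. 3.4 (v)**
(`FrdI.Thm34v_holds`: `C` of standard type by Thm. 1.2 (i), (b) vacuous, `Dᵢ` slim): an EQUIVALENCE of the small bases with
`η : Ψ ⋙ Base₂ ≅ Base₁ ⋙ Ψ_Base`. [cite: MochizukiFrdII2008, Thm 2.4 (i) p.19] -/
theorem exists_baseEquivalence :
    ∃ ΨB : RelCosetCat P₁₀ ≌ RelCosetCat P₂₀,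
      Nonempty (Ψ.functor ⋙ ModelFrobenioid.baseFunctor d₂.Φ d₂.B d₂.divB ≅
        ModelFrobenioid.baseFunctor d₁.Φ d₁.B d₁.divB ⋙ ΨB.functor) := by
  obtain ⟨-, -, ΨBase, ⟨hEq, ⟨η⟩, -⟩, -⟩ :=
    FrdI.Thm34v_holds d₁.structureFunctor d₂.structureFunctor d₁.rel_isFrobenioid d₂.rel_isFrobenioid Ψ
      d₁.rel_isOfStandardType d₂.rel_isOfStandardType (hypB_rel Ψ) (Datum.rel_isSlim_base hP₁ hZ₁)
      (Datum.rel_isSlim_base hP₂ hZ₂)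
  haveI := hEq
  exact ⟨ΨBase.asEquivalence, ⟨η⟩⟩

include hP₁ hZ₁ hP₂ hZ₂ in
/-- **"`Ψ` preserves `O^⊳(−)`" as an EQUIVALENCE of memberships — from [FrdI] Thm. 3.4 (iv)** (`FrdI.Thm34iv_holds` for `Ψ` and
for `Ψ⁻¹`, slim ⇒ Frobenius-slim bases; the converse through `Ψ⁻¹Ψ f = u⁻¹ f u` and conjugation-invariance of `O^⊳`): the
input hO of abc-iut-L1-t7's chain. [cite: MochizukiFrdII2008, Thm 2.4 (i) p.19] -/
theorem map_mem_endSubmonoid_iff (A : d₁.frobenioid) (f : A ⟶ A) :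
    f ∈ PreFrobenioid.endSubmonoid d₁.structureFunctor A ↔
      Ψ.functor.map f ∈ PreFrobenioid.endSubmonoid d₂.structureFunctor (Ψ.functor.obj A) := by
  have h12 := (FrdI.Thm34iv_holds d₁.structureFunctor d₂.structureFunctor d₁.rel_isFrobenioid d₂.rel_isFrobenioid Ψ
    d₁.rel_isOfStandardType d₂.rel_isOfStandardType (hypB_rel Ψ) (Datum.rel_isSlim_base hP₁ hZ₁).isFrobeniusSlim
    (Datum.rel_isSlim_base hP₂ hZ₂).isFrobeniusSlim).1
  have h21 := (FrdI.Thm34iv_holds d₂.structureFunctor d₁.structureFunctor d₂.rel_isFrobenioid d₁.rel_isFrobenioid Ψ.symm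
    d₂.rel_isOfStandardType d₁.rel_isOfStandardType (hypB_rel Ψ.symm) (Datum.rel_isSlim_base hP₂ hZ₂).isFrobeniusSlim
    (Datum.rel_isSlim_base hP₁ hZ₁).isFrobeniusSlim).1
  constructor
  · exact fun hf => h12 A f hf
  · intro hf
    have h := h21 (Ψ.functor.obj A) (Ψ.functor.map f) hf
    have hconj : Ψ.symm.functor.map (Ψ.functor.map f) = Ψ.unitInv.app A ≫ f ≫ Ψ.unit.app A := Ψ.inv_fun_map A A f
    rw [hconj] at h
    exact d₁.mem_endSubmonoid_of_conj_mem (Ψ.unitIso.app A) h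

/-- **THE base equivalence `Ψ_Base`** (chosen). [cite: MochizukiFrdII2008, Thm 2.4 (i) p.19] -/
def baseEquivalenceOf : RelCosetCat P₁₀ ≌ RelCosetCat P₂₀ := (exists_baseEquivalence hP₁ hZ₁ hP₂ hZ₂ Ψ).choose

/-- **THE 1-compatibility `η : Ψ ⋙ Base₂ ≅ Base₁ ⋙ Ψ_Base`** (chosen). [cite: MochizukiFrdII2008, Thm 2.4 (i) p.19] -/
def baseEquivalenceIso :
    Ψ.functor ⋙ ModelFrobenioid.baseFunctor d₂.Φ d₂.B d₂.divB ≅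
      ModelFrobenioid.baseFunctor d₁.Φ d₁.B d₁.divB ⋙ (baseEquivalenceOf hP₁ hZ₁ hP₂ hZ₂ Ψ).functor :=
  (exists_baseEquivalence hP₁ hZ₁ hP₂ hZ₂ Ψ).choose_spec.some

end TwoData

end PadicFrd

/-! ### §3 Theorem 2.4 (i) over general bases from `Ψ` alone -/

namespace PadicKummer.Def22Context

open CategoryTheory Field IntermediateField Kummer Function
open Literature.NumberTheory.GaloisRepresentations
open Literature.AnabelianGeometry.SemiGraphs QuasiTemperoid PadicFrd PadicFrd.Datum PadicFrd.Datum.GaloisChart PadicFrd.RelGal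

variable {p₁ p₂ : ℕ} [Fact p₁.Prime] [Fact p₂.Prime]
  {P₁ : Type} [Group P₁] [TopologicalSpace P₁] [IsTopologicalGroup P₁] [SecondCountableTopology P₁] (hP₁ : IsTempered P₁)
  (hZ₁ : IsSlimGroup P₁) {φ₁ : P₁ →* GalFbar ℚ_[p₁]} {hφ₁ : IsOpenHom φ₁} {P₁₀ : OpenSubgroup P₁}
  {d₁ : PadicFrd.Datum (RelCosetCat P₁₀) p₁} (hd₁ : d₁.base = relBaseGal p₁ P₁₀ φ₁ hφ₁)
  {P₂ : Type} [Group P₂] [TopologicalSpace P₂] [IsTopologicalGroup P₂] (hP₂ : IsTempered P₂) (hZ₂ : IsSlimGroup P₂)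
  {φ₂ : P₂ →* GalFbar ℚ_[p₂]} {hφ₂ : IsOpenHom φ₂} {P₂₀ : OpenSubgroup P₂}
  {d₂ : PadicFrd.Datum (RelCosetCat P₂₀) p₂} (hd₂ : d₂.base = relBaseGal p₂ P₂₀ φ₂ hφ₂)
  (Ψ : d₁.frobenioid ≌ d₂.frobenioid)
  {A₁ : d₁.frobenioid} (hA₁ : A₁.base.obj.sg.toSubgroup.Normal) (hA₂ : (Ψ.functor.obj A₁).base.obj.sg.toSubgroup.Normal)
  {H₁ : Subgroup (absoluteGaloisGroup (baseFld p₁ φ₁ hφ₁))} [H₁.Normal]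
  {hH₁ : IsOpen (H₁ : Set (absoluteGaloisGroup (baseFld p₁ φ₁ hφ₁)))}
  {H₂ : Subgroup (absoluteGaloisGroup (baseFld p₂ φ₂ hφ₂))} [H₂.Normal]
  {hH₂ : IsOpen (H₂ : Set (absoluteGaloisGroup (baseFld p₂ φ₂ hφ₂)))}
  (map_H : H₁.map (isoGOfTheta φ₁ hφ₁ φ₂ hφ₂ Ψ.functor
    (thetaOfBase hP₁ hP₂ Ψ.functor (baseEquivalenceOf hP₁ hZ₁ hP₂ hZ₂ Ψ) (baseEquivalenceIso hP₁ hZ₁ hP₂ hZ₂ Ψ))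
    (continuous_thetaOfBase hP₁ hP₂ Ψ.functor (baseEquivalenceOf hP₁ hZ₁ hP₂ hZ₂ Ψ) (baseEquivalenceIso hP₁ hZ₁ hP₂ hZ₂ Ψ))
    (isOpenMap_thetaOfBase hP₁ hP₂ Ψ.functor (baseEquivalenceOf hP₁ hZ₁ hP₂ hZ₂ Ψ) (baseEquivalenceIso hP₁ hZ₁ hP₂ hZ₂ Ψ))
    (bijective_thetaOfBase hP₁ hP₂ Ψ.functor (baseEquivalenceOf hP₁ hZ₁ hP₂ hZ₂ Ψ) (baseEquivalenceIso hP₁ hZ₁ hP₂ hZ₂ Ψ)).2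
    (hker_thetaOfBase hP₁ φ₁ hφ₁ hd₁ hP₂ φ₂ hφ₂ hd₂ Ψ.functor (baseEquivalenceOf hP₁ hZ₁ hP₂ hZ₂ Ψ)
      (baseEquivalenceIso hP₁ hZ₁ hP₂ hZ₂ Ψ) (map_mem_endSubmonoid_iff hP₁ hZ₁ hP₂ hZ₂ Ψ))
    (baseIsoOfPush Ψ.functor
      (thetaOfBase hP₁ hP₂ Ψ.functor (baseEquivalenceOf hP₁ hZ₁ hP₂ hZ₂ Ψ) (baseEquivalenceIso hP₁ hZ₁ hP₂ hZ₂ Ψ))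
      (isOpenMap_thetaOfBase hP₁ hP₂ Ψ.functor (baseEquivalenceOf hP₁ hZ₁ hP₂ hZ₂ Ψ) (baseEquivalenceIso hP₁ hZ₁ hP₂ hZ₂ Ψ))
      (basePushIsoOfBase hP₁ hP₂ Ψ.functor (baseEquivalenceOf hP₁ hZ₁ hP₂ hZ₂ Ψ) (baseEquivalenceIso hP₁ hZ₁ hP₂ hZ₂ Ψ))
      A₁)).toMulEquiv.toMonoidHom = H₂)
  (N : ℕ) [NeZero N]
  (hμ₁ : ∀ ζ : rootsOfUnity N (AlgebraicClosure (baseFld p₁ φ₁ hφ₁)),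
    ((ζ : (AlgebraicClosure (baseFld p₁ φ₁ hφ₁))ˣ) : AlgebraicClosure (baseFld p₁ φ₁ hφ₁)) ∈ objL φ₁ hφ₁ d₁ A₁)
  (hμ₂ : ∀ ζ : rootsOfUnity N (AlgebraicClosure (baseFld p₂ φ₂ hφ₂)),
    ((ζ : (AlgebraicClosure (baseFld p₂ φ₂ hφ₂))ˣ) : AlgebraicClosure (baseFld p₂ φ₂ hφ₂)) ∈
      objL φ₂ hφ₂ d₂ (Ψ.functor.obj A₁))

/-- **The isomorphism of Definition 2.2 contexts of `A₁`, `Ψ A₁` induced by the EQUIVALENCE `Ψ`** (everything structural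
chosen / derived from `Ψ`). [cite: MochizukiFrdII2008, Thm 2.4 (i) p.19] -/
def isoOfEquivalenceRel :
    (contextOfObjectRel φ₁ hφ₁ d₁ hd₁ A₁ hA₁ H₁ hH₁).Iso (contextOfObjectRel φ₂ hφ₂ d₂ hd₂ (Ψ.functor.obj A₁) hA₂ H₂ hH₂) :=
  isoOfFunctorRelBaseEquivalence hP₁ hd₁ hP₂ hd₂ Ψ.functor (baseEquivalenceOf hP₁ hZ₁ hP₂ hZ₂ Ψ)
    (baseEquivalenceIso hP₁ hZ₁ hP₂ hZ₂ Ψ) (map_mem_endSubmonoid_iff hP₁ hZ₁ hP₂ hZ₂ Ψ) hA₁ hA₂ map_H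

/-- **[FrdII] Theorem 2.4 (i) for the `p`-adic Frobenioids over GENERAL bases `Dᵢ = B^temp(Πᵢ, Πᵢ°)⁰` from an EQUIVALENCE
`Ψ : C₁ ⥲ C₂` and print's standing hypotheses (`Πᵢ` temp-slim tempered, `Π₁` Galois-countable, `Πᵢ → G_{ℚ_{pᵢ}}` open
homomorphisms), modulo EXACTLY {map_H — the printed ASSUMPTION "this isomorphism `G₁ ⥲ G₂` maps `H₁` onto `H₂`" (for the chosen
representative), hfs — "`Φ₁` is fieldwise saturated if and only if `Φ₂` is" (row L03)}.**  For `A₁` with `(A₁)_D`, `(Ψ A₁)_D`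
Galois, `μ_N(K̄ᵢ) ⊆ Lᵢ`, `A₁` `(N, H₁)`-saturated and any normalisation `F_N(A₁) ≅ ℤ/N`, the typed `Thm24i` holds for the contexts
of `A₁`, `Ψ A₁`, the comparison data induced by `Ψ` and the cup-product duality isomorphisms.  ALL structural inputs of the
chain — `Ψ_Base` and its 1-compatibility `η` ([FrdI] Thm. 3.4 (v)), "`Ψ` preserves `O^⊳`" ([FrdI] Thm. 3.4 (iv)), the outer
isomorphism of topological groups `Π₁ ⥲ Π₂` ([SemiAnbd] Prop. 3.2) with "`Ψ_Base = θ_*`", "lies over `G₁ ⥲ G₂`" (Thm. 1.2 (ii)),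
`isoG`, `houter`, `hbase`, `p₁ = p₂`, local compactness, the saturation transfer and the Kummer/reciprocity compatibilities — are
THEOREMS or CONSTRUCTIONS of the tree. [cite: MochizukiFrdII2008, Thm 2.4 (i) p.19] -/
theorem thm24i_ofEquivalenceRel (fs₁ fs₂ : Prop) (hfs : fs₁ ↔ fs₂)
    (eFN₁ : FN (contextOfObjectRel φ₁ hφ₁ d₁ hd₁ A₁ hA₁ H₁ hH₁) N ≃+ ZMod N)
    (hc₁ : IsNHSaturated (contextOfObjectRel φ₁ hφ₁ d₁ hd₁ A₁ hA₁ H₁ hH₁) N) :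
    haveI := finiteDimensional_objL φ₁ hφ₁ d₁ A₁; haveI := normal_objL φ₁ hφ₁ d₁ A₁ hA₁
    haveI := finiteDimensional_objL φ₂ hφ₂ d₂ (Ψ.functor.obj A₁)
    haveI := normal_objL φ₂ hφ₂ d₂ (Ψ.functor.obj A₁) hA₂
    haveI := finiteDimensional_baseFld p₁ φ₁ hφ₁; haveI := finiteDimensional_baseFld p₂ φ₂ hφ₂
    haveI := locallyCompactSpace_H_contextOfObjectRel φ₁ hφ₁ d₁ hd₁ A₁ hA₁ H₁ hH₁
    haveI := locallyCompactSpace_H_contextOfObjectRel φ₂ hφ₂ d₂ hd₂ (Ψ.functor.obj A₁) hA₂ H₂ hH₂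
    letI := (galoisChartRel φ₁ hφ₁ d₁ hd₁ A₁ hA₁).galAction
    letI := (galoisChartRel φ₂ hφ₂ d₂ hd₂ (Ψ.functor.obj A₁) hA₂).galAction
    Thm24i (contextOfObjectRel φ₁ hφ₁ d₁ hd₁ A₁ hA₁ H₁ hH₁)
      (contextOfObjectRel φ₂ hφ₂ d₂ hd₂ (Ψ.functor.obj A₁) hA₂ H₂ hH₂) N p₁ p₂ fs₁ fs₂
      ((isoOfEquivalenceRel hP₁ hZ₁ hd₁ hP₂ hZ₂ hd₂ Ψ hA₁ hA₂ map_H).thm24Data N)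
      ((contextOfObjectRel φ₁ hφ₁ d₁ hd₁ A₁ hA₁ H₁ hH₁).dualityIsoOfLocalDuality N eFN₁ hc₁
        (cupDualH_bijective_ofGalois_mlf p₁ (objL φ₁ hφ₁ d₁ A₁) H₁ hH₁ (galoisChartRel φ₁ hφ₁ d₁ hd₁ A₁ hA₁).res
          (galoisChartRel φ₁ hφ₁ d₁ hd₁ A₁ hA₁).res_smul ((galoisChartRel φ₁ hφ₁ d₁ hd₁ A₁ hA₁).muModel N hμ₁)))
      ((contextOfObjectRel φ₂ hφ₂ d₂ hd₂ (Ψ.functor.obj A₁) hA₂ H₂ hH₂).dualityIsoOfLocalDuality N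
        (((isoOfEquivalenceRel hP₁ hZ₁ hd₁ hP₂ hZ₂ hd₂ Ψ hA₁ hA₂ map_H).isoFN N).symm.trans eFN₁)
        (((isoOfEquivalenceRel hP₁ hZ₁ hd₁ hP₂ hZ₂ hd₂ Ψ hA₁ hA₂ map_H).isNHSaturated_iff N).mp hc₁)
        (cupDualH_bijective_ofGalois_mlf p₂ (objL φ₂ hφ₂ d₂ (Ψ.functor.obj A₁)) H₂ hH₂
          (galoisChartRel φ₂ hφ₂ d₂ hd₂ (Ψ.functor.obj A₁) hA₂).res
          (galoisChartRel φ₂ hφ₂ d₂ hd₂ (Ψ.functor.obj A₁) hA₂).res_smul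
          ((galoisChartRel φ₂ hφ₂ d₂ hd₂ (Ψ.functor.obj A₁) hA₂).muModel N hμ₂))) :=
  thm24i_ofFunctorRel_ofBaseEquivalence hP₁ hd₁ hP₂ hd₂ Ψ.functor (baseEquivalenceOf hP₁ hZ₁ hP₂ hZ₂ Ψ)
    (baseEquivalenceIso hP₁ hZ₁ hP₂ hZ₂ Ψ) (map_mem_endSubmonoid_iff hP₁ hZ₁ hP₂ hZ₂ Ψ) hA₁ hA₂ map_H N hμ₁ hμ₂
    fs₁ fs₂ hfs eFN₁ hc₁

end PadicKummer.Def22Context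

end Literature.AlgebraicGeometry.Frobenioids

end
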